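import Summits.QuantumAdvantage.QuantumAdvantage.Theorems.CubicForrelationNearExactIsExactTenUnbalancedCells

/-!
# Crux `CubicForrelation.NearExactIsExact` (stmt-QuantumAdvantage-14043), line `direct-sum-amplification`, lead c6 cycle 2:
  isolation at `θ = 7/8` on 10 bits, modulo the finite census

`isolation_ten_78_of_census`: if the 8-bit cell congruence system of `ten_unbalanced_cells` has no solution (CENSUS₁₀),
then for all cubic `f, g : 𝔽₂¹⁰ → 𝔽₂`, `Φ(f,g) > 7/8 ⇒ Φ(f,g) = 1`.
The hypothesis is explicit (no axiom, no `def`): this is an honest implication. Axioms: the standard three.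

STATUS CORRECTION (2026-08-18, seat `b2b-cforr-cert`): the hypothesis CENSUS₁₀ is FALSE — the pure g-side system has
solutions (`Negative/Census10GSide.lean`, `not_census10`, kit j028094; e.g. `1 179 648` cubic `E` mod gauge for
`D = w₀w₂ ⊕ w₁w₃ ⊕ w₀ ⊕ w₄`, `Q = w₀w₁ ⊕ w₂w₃ ⊕ w₄w₅`, kit j038101) — so THIS theorem is vacuously true and certifies
nothing.  The live conditional rung is `isolation_ten_78_of_census2` / `isolation_ten_78_of_census3` (CENSUS₁₀′: the
system together with the cubic partner `f₁`).  What is PROVED at which `n`: `n ≤ 8` at `θ = 7/8` (`isolation_eight`,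
`nearExact78_le_six`); `n = 10` at `θ = 15/16` (`isolation_ten`) and — UPDATE 2026-08-18 — at `θ = 7/8`
UNCONDITIONALLY: `isolation_ten_78` (…TenIsolation78Final.lean; CENSUS₁₀′ is discharged by proof,
`census10_prime_false`, superseding the outside-Lean census); `7/8` is attained at `n = 10` (`forrelation_fT_gT`) and `15/16` at `n = 16`
(`Negative/FifteenSixteenths.lean`), so `7/8` is NOT the global sharp constant of the crux (any `θ` needs `θ ≥ 15/16`).
-/

set_option linter.dupNamespace false -- D-0017: single-problem summit ⇒ `QuantumAdvantage.QuantumAdvantage` by design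

noncomputable section

namespace Summit.QuantumAdvantage.QuantumAdvantage.Theorems.CubicForrelation.NearExactIsExact

open Finset
open Literature.Computability.QuantumComplexity

/-- **Isolation at `7/8` on 10 bits, modulo the pure g-side census CENSUS₁₀ — VACUOUS.** If the finite cell system of
`ten_unbalanced_cells` has no solution — for all `E` (cubic), `D`, `Q` (quadratic) on 8 bits and `bh`, with `Q` unbalanced
of bias `< 128` in absolute value, NOT all heavy cell sums are `8·odd` while all light cell sums are `4·odd` — then for all
cubic `f, g : 𝔽₂¹⁰ → 𝔽₂`, `Φ(f,g) > 7/8 ⇒ Φ(f,g) = 1`.  CORRECTION (2026-08-18): the hypothesis is FALSE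
(`Negative.Census10.not_census10`), so this implication certifies nothing; use `isolation_ten_78_of_census2`/`3`
(CENSUS₁₀′, with the cubic partner) — since 2026-08-18 a THEOREM (`census10_prime_false`), giving the unconditional
`isolation_ten_78` (…TenIsolation78Final.lean). [lead c6 cycle 2; status b2b-cforr-cert] -/
theorem isolation_ten_78_of_census :
    (∀ (E D Q : (Fin (4 + 4) → Bool) → Bool) (bh : Bool), IsDegLeFun 3 E → IsDegLeFun 2 D → IsDegLeFun 2 Q → (∑ w, signOf (Q w)) ≠ 0 →
      |∑ w, signOf (Q w)| < 128 → (∀ (a : Bool) (x : Fin (4 + 4) → Bool), ∃ k : ℤ, (∑ w : Fin (4 + 4) →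
      Bool, if (D w = a ∧ Q w = bh) then signOf (E w) * twist w x else 0) = 8 * (2 * (k : ℝ) + 1)) → (∀ (a : Bool) (x : Fin (4 + 4) →
      Bool), ∃ k : ℤ, (∑ w : Fin (4 + 4) → Bool, if (D w = a ∧ Q w = !bh) then signOf (E w) * twist w x else 0) = 4 * (2 * (k : ℝ) + 1)) →
      False) → ∀ f g : (Fin (4 + 4 + 1 + 1) → Bool) → Bool, IsDegLeFun 3 f → IsDegLeFun 3 g → 7 / 8 < forrelation f g →
      forrelation f g = 1 := by
  intro hcensus f g hf hg hΦ
  by_contra hne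
  have hle : forrelation f g ≤ 1 := (abs_le.1 (SgnForrMem.abs_forrelation_le_one f g)).2
  have hlt : forrelation f g < 1 := lt_of_le_of_ne hle hne
  obtain ⟨E, D, Q, bh, hE, hD, hQ, hQne, hQlt, hH, hL⟩ := ten_unbalanced_cells f g hf hg hΦ hlt
  exact hcensus E D Q bh hE hD hQ hQne hQlt hH hL

end Summit.QuantumAdvantage.QuantumAdvantage.Theorems.CubicForrelation.NearExactIsExact
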